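import Literature.Barriers.Parity.SiegelZeroDichotomyChowlaModel
import Literature.Barriers.Parity.SiegelZeroDichotomyProofs
import Literature.NumberTheory.LFunctions.SiegelExceptionalZeroBound
import Mathlib.NumberTheory.Chebyshev
import Mathlib.NumberTheory.Harmonic.Bounds
import HarnessLib

/-!
# Step (i) of Tao–Teräväinen at `k = 0`, analytic tools: the size of the conductor (Siegel),
# Chebyshev's bound for `π`, and the smooth-part count `∑_{d ≤ 2R} π(2x/d) ≪ x log_x R`

Topic `Literature/Barriers/Parity`, sub-namespace `TaoTeravainen`; third file of the proof DAG of
`Literature.Barriers.Parity.TaoTeravainen2021_chowla`. Everything here is PROVED: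

* `IsSiegelZero.ne_one`, `exists_log_le_log_conductor_add` — "(1.4): From
  Siegel's theorem we have the (ineffective) upper bound `η ≪_ε q_χ^ε`", in the form
  `log η ≤ log q_χ + c` for an absolute (ineffective) `c`, from the tree's Siegel bound
  `Literature.NumberTheory.LFunctions.Siegel.exists_one_sub_realZero_ge` (MV Corollary 11.15) at
  `ε = 1`; this is how "`η` sufficiently large" makes `q_χ` and `x` large (§2.1).
  [cite: TaoTeravainen2021, (1.4) and §2.1]
* `primeCounting_floor_le` — Chebyshev: `π(y) ≤ (2 log 4 + 2) y/log y` for `y ≥ 2` (Mathlib's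
  `Chebyshev.pi_le_log4_mul_div`). [folklore]
* `sum_primeCounting_div_le` — for `e ≤ R`, `R² ≤ x`, `h ≤ x` (with the harmonic bound
  `∑_{d ≤ N} 1/d ≤ 1 + log N` inlined from Mathlib's `harmonic_le_one_add_log`):
  `∑_{1 ≤ d ≤ 2R} π((x+h)/d) ≤ 12 (2 log 4 + 2) x log R/log x`, the source's "By Mertens' theorem
  this latter quantity is `O(log_x R)`" for the count (4.5) at `k = 0` (here by Chebyshev and the
  harmonic sum instead of Lemma 3.2). [cite: TaoTeravainen2021, §4 (proof of (4.5))]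
-/

noncomputable section

open Finset Real
open scoped Nat.Prime

namespace Literature.Barriers.Parity

/-! ### The conductor of a Siegel zero is large (Siegel's theorem) -/

/-- The character of a Siegel zero is not principal (it is primitive of conductor `q ≥ 3`,
`IsSiegelZero.three_le`). [folklore] -/
theorem IsSiegelZero.ne_one {q : ℕ} [NeZero q] {χ : DirichletCharacter ℂ q} {η : ℝ}
    (h : IsSiegelZero χ η) : χ ≠ 1 := by
  intro h1
  have hq := h.three_le
  have hcond : χ.conductor = q := h.1
  rw [h1, DirichletCharacter.conductor_one] at hcond
  omega

/-- **(1.4) via Siegel's theorem**: there is an absolute (ineffective) `c` such that every Siegel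
zero of quality `η` attached to a conductor `q` has `log η ≤ log q + c` (from MV Corollary 11.15
with `ε = 1`: `C/q ≤ 1 - β = 1/(η log q)`, so `η ≤ q/(C log 2)`).
[cite: TaoTeravainen2021, (1.4)] -/
theorem exists_log_le_log_conductor_add :
    ∃ c : ℝ, ∀ (q : ℕ) [NeZero q] (χ : DirichletCharacter ℂ q) (η : ℝ), IsSiegelZero χ η →
      Real.log η ≤ Real.log q + c := by
  obtain ⟨C, hC, hS⟩ :=
    Literature.NumberTheory.LFunctions.Siegel.exists_one_sub_realZero_ge (ε := 1) one_pos
  refine ⟨-Real.log (C * Real.log 2), fun q _ χ η h => ?_⟩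
  have hq : (2 : ℝ) ≤ q := by exact_mod_cast (le_of_lt h.three_le : 2 ≤ q)
  have hq0 : (0 : ℝ) < q := by linarith
  have hlog2 : Real.log 2 ≤ Real.log q := Real.log_le_log two_pos hq
  have hl2 : 0 < Real.log 2 := Real.log_pos one_lt_two
  have hlogq : 0 < Real.log q := hl2.trans_le hlog2
  have hη : 0 < η := by linarith [h.ten_le]
  have key := hS q χ h.2.1.sq_eq_one h.ne_one (1 - 1 / (η * Real.log q)) h.2.2.2
  rw [Real.rpow_neg_one, sub_sub_cancel] at key
  -- `C/q ≤ 1/(η log q)` gives `C η log q ≤ q`, hence `η C log 2 ≤ q`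
  have h3 : C * (η * Real.log q) ≤ q := by
    have := mul_le_mul_of_nonneg_left key (by positivity : 0 ≤ (q : ℝ) * (η * Real.log q))
    calc C * (η * Real.log q) = (q : ℝ) * (η * Real.log q) * (C * (q : ℝ)⁻¹) := by
          field_simp
      _ ≤ (q : ℝ) * (η * Real.log q) * (1 / (η * Real.log q)) := this
      _ = q := by field_simp
  have h1 : η * (C * Real.log 2) ≤ q :=
    calc η * (C * Real.log 2) ≤ η * (C * Real.log q) := by gcongr
      _ = C * (η * Real.log q) := by ring
      _ ≤ q := h3
  have hpos : 0 < C * Real.log 2 := mul_pos hC hl2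
  calc Real.log η = Real.log (η * (C * Real.log 2)) - Real.log (C * Real.log 2) := by
        rw [Real.log_mul hη.ne' hpos.ne']; ring
    _ ≤ Real.log q - Real.log (C * Real.log 2) :=
        sub_le_sub_right (Real.log_le_log (mul_pos hη hpos) h1) _
    _ = Real.log q + -Real.log (C * Real.log 2) := by ring

namespace TaoTeravainen

/-! ### Chebyshev's bound -/

/-- Chebyshev: `π(⌊y⌋) ≤ (2 log 4 + 2) y / log y` for `y ≥ 2` (from Mathlib's
`π(⌊y⌋) ≤ log 4 · y/log √y + √y` and `log y ≤ 2√y`). [folklore] -/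
theorem primeCounting_floor_le {y : ℝ} (hy : 2 ≤ y) :
    (π ⌊y⌋₊ : ℝ) ≤ (2 * Real.log 4 + 2) * y / Real.log y := by
  have hy0 : 0 < y := by linarith
  have hlogy : 0 < Real.log y := Real.log_pos (by linarith)
  have h := Chebyshev.pi_le_log4_mul_div (x := y) (by linarith)
  rw [Real.log_sqrt hy0.le] at h
  have hsqrt : Real.sqrt y ≤ 2 * y / Real.log y := by
    rw [le_div_iff₀ hlogy]
    have hs0 : 0 < Real.sqrt y := Real.sqrt_pos.mpr hy0
    have h1 : Real.log (Real.sqrt y) ≤ Real.sqrt y - 1 := Real.log_le_sub_one_of_pos hs0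
    rw [Real.log_sqrt hy0.le] at h1
    nlinarith [Real.sq_sqrt hy0.le]
  calc (π ⌊y⌋₊ : ℝ) ≤ Real.log 4 * y / (Real.log y / 2) + Real.sqrt y := h
    _ ≤ Real.log 4 * y / (Real.log y / 2) + 2 * y / Real.log y := by gcongr
    _ = (2 * Real.log 4 + 2) * y / Real.log y := by field_simp

/-! ### The count (4.5) at `k = 0` -/

/-- **The smooth-part count of §4 at `k = 0`**: for `e ≤ R`, `R² ≤ x` and a shift `h ≤ x`,
`∑_{1 ≤ d ≤ 2R} π((x+h)/d) ≤ 12 (2 log 4 + 2) · x log R / log x` (`= O(x log_x R)`: Chebyshev for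
each `π(2x/d)` with `log(2x/d) ≥ ½ log x`, and `∑_{d ≤ 2R} 1/d ≤ 1 + log 2R ≤ 3 log R`).
[cite: TaoTeravainen2021, §4 (proof of (4.5): "this latter quantity is O(log_x R)")] -/
theorem sum_primeCounting_div_le {x h : ℕ} {R : ℝ} (hR : Real.exp 1 ≤ R) (hRx : R ^ 2 ≤ x)
    (hhx : h ≤ x) :
    ∑ d ∈ Icc 1 ⌊2 * R⌋₊, (π ((x + h) / d) : ℝ) ≤
      12 * (2 * Real.log 4 + 2) * x * Real.log R / Real.log x := by
  set C₀ : ℝ := 2 * Real.log 4 + 2 with hC₀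
  have hC₀0 : 0 < C₀ := by have := Real.log_pos (by norm_num : (1 : ℝ) < 4); positivity
  have he1 : 1 < Real.exp 1 := by linarith [Real.add_one_le_exp (1 : ℝ)]
  have hR1 : 1 < R := he1.trans_le hR
  have hR0 : 0 < R := by linarith
  have hlogR : 1 ≤ Real.log R := by
    rw [← Real.log_exp 1]; exact Real.log_le_log (Real.exp_pos 1) hR
  have hxR : R ≤ x := by nlinarith
  have hx1 : (1 : ℝ) < x := hR1.trans_le hxR
  have hx0 : (0 : ℝ) < x := by linarith
  have hlogx : 0 < Real.log x := Real.log_pos hx1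
  have hlogRx : Real.log R ≤ Real.log x / 2 := by
    have : Real.log (R ^ 2) ≤ Real.log x := Real.log_le_log (by positivity) hRx
    rw [Real.log_pow] at this; push_cast at this; linarith
  -- each term
  have hterm : ∀ d ∈ Icc 1 ⌊2 * R⌋₊, (π ((x + h) / d) : ℝ) ≤ 4 * C₀ * x / Real.log x * (1 / d) := by
    intro d hd
    rw [mem_Icc] at hd
    have hd0 : (0 : ℝ) < d := by exact_mod_cast hd.1
    have hdR : (d : ℝ) ≤ 2 * R := (Nat.le_floor_iff (by positivity)).mp hd.2
    set y : ℝ := 2 * (x : ℝ) / d with hy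
    have hyR : R ≤ y := by
      rw [hy, le_div_iff₀ hd0]; nlinarith
    have hy2 : 2 ≤ y := by linarith [Real.add_one_le_exp (1 : ℝ)]
    have hy0 : 0 < y := by linarith
    -- `π((x+h)/d) ≤ π(⌊y⌋) = π(2x/d)`
    have hfloor : ⌊y⌋₊ = 2 * x / d := by
      rw [hy, show (2 * (x : ℝ)) = ((2 * x : ℕ) : ℝ) by push_cast; ring, Nat.floor_div_eq_div]
    have hmono : (π ((x + h) / d) : ℝ) ≤ (π ⌊y⌋₊ : ℝ) := by
      rw [hfloor]
      exact_mod_cast Nat.monotone_primeCounting (Nat.div_le_div_right (by omega))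
    -- Chebyshev and `log y ≥ log x / 2`
    have hlogy : Real.log x / 2 ≤ Real.log y := by
      have h1 : Real.log y = Real.log 2 + Real.log x - Real.log d := by
        rw [hy, Real.log_div (by positivity) hd0.ne', Real.log_mul two_ne_zero hx0.ne']
      have hdR' : Real.log d ≤ Real.log 2 + Real.log R := by
        rw [← Real.log_mul two_ne_zero hR0.ne']; exact Real.log_le_log hd0 hdR
      linarith
    calc (π ((x + h) / d) : ℝ) ≤ (π ⌊y⌋₊ : ℝ) := hmono
      _ ≤ C₀ * y / Real.log y := primeCounting_floor_le hy2
      _ ≤ C₀ * y / (Real.log x / 2) :=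
          div_le_div_of_nonneg_left (by positivity) (by positivity) hlogy
      _ = 4 * C₀ * x / Real.log x * (1 / d) := by rw [hy]; field_simp; ring
  -- the harmonic sum
  set N : ℕ := ⌊2 * R⌋₊ with hN
  have hN1 : 1 ≤ N := Nat.le_floor (by norm_num; linarith)
  have hN0 : (0 : ℝ) < N := by exact_mod_cast hN1
  have hNR : (N : ℝ) ≤ 2 * R := Nat.floor_le (by positivity)
  have hharm : ∑ d ∈ Icc 1 N, (1 : ℝ) / d ≤ 3 * Real.log R := by
    -- the harmonic bound `∑_{d ≤ N} 1/d ≤ 1 + log N` (Mathlib's `harmonic_le_one_add_log`; cf.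
    -- `Literature.Barriers.Parity.Ford2004.sum_Icc_one_div_le`)
    have hH : ∑ d ∈ Icc 1 N, (1 : ℝ) / d ≤ 1 + Real.log N := by
      have h := harmonic_le_one_add_log N
      rw [harmonic_eq_sum_Icc, Rat.cast_sum] at h
      convert h using 2 with d
      push_cast
      ring
    refine hH.trans ?_
    have h1 : Real.log N ≤ Real.log 2 + Real.log R := by
      rw [← Real.log_mul two_ne_zero hR0.ne']; exact Real.log_le_log hN0 hNR
    have hl2 : Real.log 2 < 1 := by
      have := Real.log_two_lt_d9; linarith
    linarith
  calc ∑ d ∈ Icc 1 N, (π ((x + h) / d) : ℝ)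
      ≤ ∑ d ∈ Icc 1 N, 4 * C₀ * x / Real.log x * (1 / d) := sum_le_sum hterm
    _ = 4 * C₀ * x / Real.log x * ∑ d ∈ Icc 1 N, (1 : ℝ) / d := by rw [mul_sum]
    _ ≤ 4 * C₀ * x / Real.log x * (3 * Real.log R) :=
        mul_le_mul_of_nonneg_left hharm (by positivity)
    _ = 12 * C₀ * x * Real.log R / Real.log x := by field_simp; ring

end TaoTeravainen

end Literature.Barriers.Parity
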